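import Literature.Geometry.Symplectic.SteinBoundaryContactPositive
import Literature.Geometry.Symplectic.SteinOneHandlebodies
import HarnessLib

/-!
# The boundary contact form of a flat sublevel Stein domain `{Ψ ≤ c} ⊂ ℝ⁴`, read ambiently;
# lifting an ambient Reeb candidate to the boundary manifold

Topic `Literature/Geometry/Symplectic`; a proofs-only file (no definition, no named fact)
serving the Reeb criterion `SteinStructure.isGirouxForm_boundaryContactForm_of_reebField`
(`LefschetzSteinOpenBookReeb.lean`) for the Stein structures `(J₀|, Ψ|)` on compact regular
sublevel sets `W = {Ψ ≤ c} ⊂ ℝ⁴` of `exists_steinStructure_sublevel_of_levi_pos`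
(`LefschetzBaseLevi.lean`; `S.J = sublevelJ h J₀`, `S.φ = sublevelPhi h`), in particular for
the base-case models of `palf_stein_supportedByBoundaryOpenBook`
(`LefschetzBaseModelStein.lean`, `LefschetzBaseSteinModel.lean`).  For a boundary datum `b` of
`W` write `ι y = incl (b.incl y) ∈ ℝ⁴` and `D_y u = Dι (d(b.incl)_y u) ∈ ℝ⁴` for the ambient
image of a tangent vector `u ∈ ℝ³` of `b.carrier` at `y`.  Then (§1, the dictionary):

* `contactForm_sublevel`, `kahlerForm_sublevel` — `α_x(v) = -DΨ(J₀ Dι v)` and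
  `ω_x(u, v) = -(D²Ψ(Dι u, J₀ Dι v) - D²Ψ(Dι v, J₀ Dι u))` (`SteinOneHandlebodies.lean` §4);
* `boundaryContactForm_sublevel`, `mextDeriv_boundaryContactForm_sublevel` — the canonical
  boundary form `β = b.incl^*(-d^ℂφ)` and `dβ` on `u, v`: `β_y(u) = -DΨ_{ι y}(J₀ D_y u)`,
  `dβ_y(u, v) = -(D²Ψ(D_y u, J₀ D_y v) - D²Ψ(D_y v, J₀ D_y u))` (`liouvilleForm_pullback`);
* `fderiv_apply_ambient_eq_zero`, `exists_ambient_eq` — `D_y u ∈ ker DΨ_{ι y}`, and conversely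
  **every ambient vector `V ∈ ker DΨ_{ι y}` is `D_y u` for some `u`** (`exists_mfderiv_incl_eq`).

And (§2) the lift: for an ambient field `V` tangent to the level along the boundary there is
`R : b.carrier → ℝ³` with `D_y (R y) = V (ι y)` (`exists_reebLift`), whence
**`β(R) = -DΨ(J₀ V)` and `dβ(R, z) = -(D²Ψ(V, J₀ D z) - D²Ψ(D z, J₀ V))`**; so the first two
clauses of the Reeb criterion (`β(R) > 0`, `ι_R dβ = 0`) follow from the AMBIENT conditions
`-DΨ(J₀ V) > 0` and `D²Ψ(V, J₀ w) = D²Ψ(w, J₀ V)` for `w ∈ ker DΨ` (`reeb_clauses_of_ambient`) —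
satisfied by `V = J₀ ∇^{g_Ψ} Ψ`, the `J₀`-rotated gradient of `Ψ` for its Levi metric
(Cieliebak–Eliashberg 2012, Ch. 2; Etnyre 2006, Lemma 3.3).

## References

* K. Cieliebak, Ya. Eliashberg, *From Stein to Weinstein and Back*, AMS Coll. Publ. 59 (2012),
  Ch. 2. [CieliebakEliashberg2012]
* J. B. Etnyre, *Lectures on open book decompositions and contact structures*, Clay Math.
  Proc. 5 (2006), Lemma 3.3. [Etnyre2006]
-/

noncomputable section

open scoped Manifold ContDiff Topology
open Set Function

namespace Literature.Geometry.Symplectic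

open Literature.Topology.FourManifolds Literature.Geometry.Kaehler

variable {Ψ : EuclideanSpace ℝ (Fin 4) → ℝ} {c : ℝ} {h : IsRegularLevel (𝓡 4) Ψ c}
  [CompactSpace (RegularSublevel h)]
  {J₀ : EuclideanSpace ℝ (Fin 4) →L[ℝ] EuclideanSpace ℝ (Fin 4)}
  {S : SteinStructure (RegularSublevel h)}

/-! ### §1 The dictionary -/

/-- **`α_x(v) = -DΨ_{ι x}(J₀ Dι_x v)`** for the sublevel Stein structure `(J₀|, Ψ|)`.
[cite: CieliebakEliashberg2012, Ch. 2] -/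
theorem contactForm_sublevel (hSφ : S.φ = sublevelPhi h) (hSJ : S.J = sublevelJ h J₀)
    (x : RegularSublevel h) (v : EuclideanSpace ℝ (Fin 4)) :
    S.contactForm x v = -(fderiv ℝ Ψ (RegularSublevel.incl h x) (J₀ (inclDeriv h x v))) := by
  rw [SteinStructure.contactForm_apply, SteinStructure.dφ, hSφ, hSJ]
  have h1 := mfderiv_sublevelPhi_apply h x (sublevelJ h J₀ x v)
  rw [inclDeriv_sublevelJ] at h1
  exact congrArg Neg.neg h1

/-- **`ω_x(u, v) = -(D²Ψ(Dι u, J₀ Dι v) - D²Ψ(Dι v, J₀ Dι u))`** for the sublevel Stein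
structure. [cite: CieliebakEliashberg2012, Ch. 2] -/
theorem kahlerForm_sublevel (hSφ : S.φ = sublevelPhi h) (hSJ : S.J = sublevelJ h J₀)
    (x : RegularSublevel h) (u v : EuclideanSpace ℝ (Fin 4)) :
    S.kahlerForm x u v =
      -(fderiv ℝ (fderiv ℝ Ψ) (RegularSublevel.incl h x) (inclDeriv h x u) (J₀ (inclDeriv h x v)) -
        fderiv ℝ (fderiv ℝ Ψ) (RegularSublevel.incl h x) (inclDeriv h x v)
          (J₀ (inclDeriv h x u))) := by
  rw [SteinStructure.kahlerForm, hSJ, hSφ, mextDeriv_dComplex_sublevel]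
  change -(extDeriv (dComplexFlat J₀ Ψ) (RegularSublevel.incl h x)
    ((inclDeriv h x : EuclideanSpace ℝ (Fin 4) →L[ℝ] EuclideanSpace ℝ (Fin 4)) ∘ ![u, v])) = _
  have hv : ((inclDeriv h x : EuclideanSpace ℝ (Fin 4) →L[ℝ] EuclideanSpace ℝ (Fin 4)) ∘ ![u, v]) =
      ![inclDeriv h x u, inclDeriv h x v] := by
    funext i; fin_cases i <;> rfl
  rw [hv, extDeriv_dComplexFlat_apply J₀ (contDiff_of_isRegularLevel h)]

variable (b : BoundaryData (𝓡∂ 4) (RegularSublevel h) (𝓡 3))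

/-- **`β_y(u) = -DΨ_{ι y}(J₀ D_y u)`** for the canonical boundary contact form
`β = b.incl^*(-d^ℂφ)`. [cite: CieliebakEliashberg2012, Ch. 2] -/
theorem boundaryContactForm_sublevel (hSφ : S.φ = sublevelPhi h) (hSJ : S.J = sublevelJ h J₀)
    (y : b.carrier) (u : EuclideanSpace ℝ (Fin 3)) :
    S.boundaryContactForm b y ![u] =
      -(fderiv ℝ Ψ (RegularSublevel.incl h (b.incl y))
        (J₀ (inclDeriv h (b.incl y) (mfderiv (𝓡 3) (𝓡∂ 4) b.incl y u)))) := by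
  rw [S.boundaryContactForm_apply_one, contactForm_sublevel hSφ hSJ]

/-- **`dβ_y(u, v) = -(D²Ψ(D_y u, J₀ D_y v) - D²Ψ(D_y v, J₀ D_y u))`.**
[cite: CieliebakEliashberg2012, Ch. 2] -/
theorem mextDeriv_boundaryContactForm_sublevel (hSφ : S.φ = sublevelPhi h)
    (hSJ : S.J = sublevelJ h J₀) (y : b.carrier) (u v : EuclideanSpace ℝ (Fin 3)) :
    mextDeriv (S.boundaryContactForm b) y ![u, v] =
      -(fderiv ℝ (fderiv ℝ Ψ) (RegularSublevel.incl h (b.incl y))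
          (inclDeriv h (b.incl y) (mfderiv (𝓡 3) (𝓡∂ 4) b.incl y u))
          (J₀ (inclDeriv h (b.incl y) (mfderiv (𝓡 3) (𝓡∂ 4) b.incl y v))) -
        fderiv ℝ (fderiv ℝ Ψ) (RegularSublevel.incl h (b.incl y))
          (inclDeriv h (b.incl y) (mfderiv (𝓡 3) (𝓡∂ 4) b.incl y v))
          (J₀ (inclDeriv h (b.incl y) (mfderiv (𝓡 3) (𝓡∂ 4) b.incl y u)))) := by
  have key := (liouvilleForm_pullback S b.isSmoothEmbedding.contMDiff).2.2 y u v
  rw [SteinStructure.boundaryContactForm]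
  rw [key, kahlerForm_sublevel hSφ hSJ]

/-- **Tangent vectors of the boundary manifold are tangent to the level**:
`DΨ_{ι y}(D_y u) = 0`. [folklore] -/
theorem fderiv_apply_ambient_eq_zero (hSφ : S.φ = sublevelPhi h) (y : b.carrier)
    (u : EuclideanSpace ℝ (Fin 3)) :
    fderiv ℝ Ψ (RegularSublevel.incl h (b.incl y))
      (inclDeriv h (b.incl y) (mfderiv (𝓡 3) (𝓡∂ 4) b.incl y u)) = 0 := by
  have hx : (𝓡∂ 4).IsBoundaryPoint (b.incl y) := b.incl_mem_boundary y
  have h0 := (mem_boundaryTangentSpace_iff _).1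
    (mfderiv_apply_mem_boundaryTangentSpace b.incl (b.incl_mem_boundary y) u)
  have h1 := S.mfderiv_φ_apply_eq_zero hx h0
  rw [SteinStructure.dφ, hSφ] at h1
  exact (mfderiv_sublevelPhi_apply h (b.incl y) _).symm.trans h1

/-- **Every ambient vector tangent to the level at `ι y` is the image of a tangent vector of the
boundary manifold at `y`.** [folklore] -/
theorem exists_ambient_eq (hSφ : S.φ = sublevelPhi h) (y : b.carrier)
    {V : EuclideanSpace ℝ (Fin 4)} (hV : fderiv ℝ Ψ (RegularSublevel.incl h (b.incl y)) V = 0) :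
    ∃ u : EuclideanSpace ℝ (Fin 3),
      inclDeriv h (b.incl y) (mfderiv (𝓡 3) (𝓡∂ 4) b.incl y u) = V := by
  have hx : (𝓡∂ 4).IsBoundaryPoint (b.incl y) := b.incl_mem_boundary y
  set v : EuclideanSpace ℝ (Fin 4) := (inclDeriv h (b.incl y)).symm V with hv
  have hdφ : S.dφ (b.incl y) v = 0 := by
    rw [SteinStructure.dφ, hSφ]
    refine (mfderiv_sublevelPhi_apply h (b.incl y) v).trans ?_
    rw [hv, ContinuousLinearEquiv.apply_symm_apply]
    exact hV
  have hv0 : v 0 = 0 := (S.mfderiv_φ_apply_eq_zero_iff hx v).1 hdφ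
  obtain ⟨u, hu⟩ := exists_mfderiv_incl_eq b y ((mem_boundaryTangentSpace_iff v).2 hv0)
  refine ⟨u, ?_⟩
  rw [hu, hv, ContinuousLinearEquiv.apply_symm_apply]

/-! ### §2 Lifting an ambient Reeb candidate -/

/-- **Lift of an ambient field tangent to the boundary level.**  If `V : ℝ⁴ → ℝ⁴` is tangent to
the level at every boundary point (`DΨ_{ι y}(V(ι y)) = 0`), there is a field `R` on `b.carrier`
with `D_y (R y) = V (ι y)`; then `β(R y) = -DΨ(J₀ V)` and
`dβ_y(R y, z) = -(D²Ψ(V, J₀ D_y z) - D²Ψ(D_y z, J₀ V))` at `ι y`.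
[cite: Etnyre2006, Lemma 3.3] -/
theorem exists_reebLift (hSφ : S.φ = sublevelPhi h) (hSJ : S.J = sublevelJ h J₀)
    (V : EuclideanSpace ℝ (Fin 4) → EuclideanSpace ℝ (Fin 4))
    (hVt : ∀ y : b.carrier, fderiv ℝ Ψ (RegularSublevel.incl h (b.incl y))
      (V (RegularSublevel.incl h (b.incl y))) = 0) :
    ∃ R : b.carrier → EuclideanSpace ℝ (Fin 3),
      (∀ y, inclDeriv h (b.incl y) (mfderiv (𝓡 3) (𝓡∂ 4) b.incl y (R y)) =
        V (RegularSublevel.incl h (b.incl y))) ∧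
      (∀ y, S.boundaryContactForm b y ![R y] =
        -(fderiv ℝ Ψ (RegularSublevel.incl h (b.incl y))
          (J₀ (V (RegularSublevel.incl h (b.incl y)))))) ∧
      ∀ (y : b.carrier) (z : EuclideanSpace ℝ (Fin 3)),
        mextDeriv (S.boundaryContactForm b) y ![R y, z] =
          -(fderiv ℝ (fderiv ℝ Ψ) (RegularSublevel.incl h (b.incl y))
              (V (RegularSublevel.incl h (b.incl y)))
              (J₀ (inclDeriv h (b.incl y) (mfderiv (𝓡 3) (𝓡∂ 4) b.incl y z))) -
            fderiv ℝ (fderiv ℝ Ψ) (RegularSublevel.incl h (b.incl y))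
              (inclDeriv h (b.incl y) (mfderiv (𝓡 3) (𝓡∂ 4) b.incl y z))
              (J₀ (V (RegularSublevel.incl h (b.incl y))))) := by
  choose R hR using fun y => exists_ambient_eq (S := S) b hSφ y (hVt y)
  refine ⟨R, hR, fun y => ?_, fun y z => ?_⟩
  · rw [boundaryContactForm_sublevel b hSφ hSJ, hR]
  · rw [mextDeriv_boundaryContactForm_sublevel b hSφ hSJ, hR]

/-- **The first two clauses of the Reeb criterion from ambient conditions.**  If moreover
`-DΨ(J₀ V) > 0` and `D²Ψ(V, J₀ w) = D²Ψ(w, J₀ V)` for all `w ∈ ker DΨ` at every boundary point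
(i.e. `V` spans the kernel of `ω_Ψ = -dd^ℂΨ` restricted to the level and is positive for
`-d^ℂΨ`), then the lift `R` satisfies `β(R) > 0` and `ι_R dβ = 0` — the hypotheses `hαR`, `hιR`
of `SteinStructure.isGirouxForm_boundaryContactForm_of_reebField`. [cite: Etnyre2006, Lemma 3.3] -/
theorem reeb_clauses_of_ambient (hSφ : S.φ = sublevelPhi h) (hSJ : S.J = sublevelJ h J₀)
    (V : EuclideanSpace ℝ (Fin 4) → EuclideanSpace ℝ (Fin 4))
    (hVt : ∀ y : b.carrier, fderiv ℝ Ψ (RegularSublevel.incl h (b.incl y))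
      (V (RegularSublevel.incl h (b.incl y))) = 0)
    (hVpos : ∀ y : b.carrier, 0 < -(fderiv ℝ Ψ (RegularSublevel.incl h (b.incl y))
      (J₀ (V (RegularSublevel.incl h (b.incl y))))))
    (hVker : ∀ (y : b.carrier) (w : EuclideanSpace ℝ (Fin 4)),
      fderiv ℝ Ψ (RegularSublevel.incl h (b.incl y)) w = 0 →
      fderiv ℝ (fderiv ℝ Ψ) (RegularSublevel.incl h (b.incl y))
          (V (RegularSublevel.incl h (b.incl y))) (J₀ w) =
        fderiv ℝ (fderiv ℝ Ψ) (RegularSublevel.incl h (b.incl y)) w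
          (J₀ (V (RegularSublevel.incl h (b.incl y))))) :
    ∃ R : b.carrier → EuclideanSpace ℝ (Fin 3),
      (∀ y, inclDeriv h (b.incl y) (mfderiv (𝓡 3) (𝓡∂ 4) b.incl y (R y)) =
        V (RegularSublevel.incl h (b.incl y))) ∧
      (∀ y, 0 < S.boundaryContactForm b y ![R y]) ∧
      ∀ (y : b.carrier) (z : EuclideanSpace ℝ (Fin 3)),
        mextDeriv (S.boundaryContactForm b) y ![R y, z] = 0 := by
  obtain ⟨R, hR, hα, hd⟩ := exists_reebLift b hSφ hSJ V hVt
  refine ⟨R, hR, fun y => by rw [hα]; exact hVpos y, fun y z => ?_⟩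
  rw [hd, hVker y _ (fderiv_apply_ambient_eq_zero (S := S) b hSφ y z), sub_self, neg_zero]

end Literature.Geometry.Symplectic

end
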